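import Summits.Ventures.HSemireg.CensusG6Table
import HarnessLib

/-!
# Venture HSemireg — § V-1 ∕ V-2 (g = 6) of the SIGNED verdict as a CERTIFIED NEGATIVE STATEMENT over the families tried:
# «NO-in-families-tried» is the value of the coordinator's three-outcome form on the DECIDING rows of the census table (kernel `decide`)

HONEST FRAMING. Bookkeeping file of a COMPUTATION cell (`pub-hsemireg`, Sunday typer seat p11, successor generation; referees
ref-3 ∕ ref-4; the g = 8 twin is p9's `CensusG8Verdict.lean`). The statements below are DECIDABLE facts about the finite table
`CensusG6.census` (file `CensusG6Table.lean` = CENSUS (g = 6) v3.77 `5d64c8087faa95c9` transcribed row by row): counts, buckets,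
and the three-outcome form computed from the table. They certify that p11's transcription REPRODUCES the numbers and words of
record of `target-g6/VERDICT-G6.md` v1.0 SIGNED `1651dcc7322662a2`, § V-1 ∕ V-2, and they make the negative statement precise:
AMONG THE 219 ROWS OF THE g = 6 CENSUS (the families tried: A, B, C, D + ladder, L, and the K calibrations), NO ROW READ ON A
NON-SPLIT (DECIDING) g = 6 COMPONENT IS CLASS-EXACT ∧ W-ALIVE ∧ SEMIREGULAR — at any multiplicity — so no YES-candidate exists; the
rows that DO carry both halves all sit on SPLIT components (METHOD INSTANCES, in print modulo [Mar25 1.5.1] ∕ [Sch88]) or are the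
g = 4 anchor; and NO ROW IS AN ALL-OBJECT BARRIER, so «STRUCTURAL-NO» is not claimed; the form on the deciding rows is therefore
«NO-in-families-tried». What is NOT checked here: the engines' exact numbers behind each cell (class decompositions, W-parts,
Ext dimensions, σ ∕ π ranks — computed ×1…×5 by the cell's codes, hash-pinned in the census), the hand theorems behind the
structure rows, the words-of-record rulings, and the modelling claims linking the cells to Bloch ∕ Buchweitz–Flenner
semiregularity (`Certificate.lean` states that contract). A census row is a statement about a NAMED object or design at a NAMED
anchor, never about a programme. NOTHING HERE SAYS THAT HC, HC_CM OR HC_AV IS PROVED OR REFUTED.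

THE SIGNED WORDS THIS FILE TYPES (VERDICT-G6.md v1.0, verbatim where quoted): V-1 FORM AT g = 6 **«NO-in-families-tried»**;
«deciding rows = the NON-SPLIT components (3, K, a), DECIDING ⇔ a ∉ Nm K^×»; «On every non-split g = 6 component of record, 0
objects pass CLASS-EXACTNESS … AND SEMIREGULARITY»; «candidates 0»; V-2 numbers «218 rows = A 59 · B 45 · C 47 · D 43 (D 39 + D-L 4)
· K 22 · L 2» at the signed pin v3.75 (+ the post-signing row C14-16 ⇒ 219, C 48); «non-split SEMIREG ∧ CLASS-OK 0; 0 YES verdict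
rows (38 SEMIREG+CLASS-worded cells all split ∕ g = 4-in-print ∕ control ∕ negative; the 9 deciding cells with a YES token UNDECIDED ∕
component ∕ conditional)»; THREE-OUTCOME SENTENCE «YES-candidate NONE · NO-in-families-tried · STRUCTURAL-NO NOT CLAIMED»; «YES as
METHOD INSTANCES on split components» (D-1 ∕ D-2…D-6 theta-secant ∕ family-C instances); door ledger of record TWO on R1: (I) the C9
placement door D-14, (II) the family-B h-seeing door B12-9 ∕ 9b ∕ 9c ∕ 10 — both UNDECIDED. The theorems are grouped: (1) the
roll-up numbers; (2) the negative statement on the deciding rows; (3) the signed «38 ∕ 9» cells by name; (4) the split method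
instances by name; (5) the three-outcome form; (6) the open rows and the two doors; (7) bookkeeping of the rows at other levels.
Every proof is `decide` ∕ `rfl` on the closed table.
-/

namespace Summit.Ventures.HSemireg.CensusG6

/-! ## Predicates on rows (the census's own tests) -/

/-- «SEMIREG ∧ CLASS» for a row: CLASS-EXACT ∧ W-ALIVE and σ ∕ π injective — BOTH halves, at whatever multiplicity the cells carry
(the multiplicity is not modelled; the YES-bar A5 additionally wants ×2 in both cells on a named non-split component). [bookkeeping] -/
def Row.semiregAndClass (r : Row) : Bool := r.cls == .ok && r.sigma == .injective

/-- A g = 6 statement: the row's level is n = 3. [bookkeeping] -/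
def Row.atThree (r : Row) : Bool := r.n == 3

/-- A DECIDING row (V-1: «deciding rows = the NON-SPLIT components (3, K, a)»): a g = 6 statement read on at least one non-split
component — the `nonsplit` rows and the family-level `any` rows (which cover the non-split components too). Split-only rows are
method-instance territory; `none` rows attach to no sixfold component. [bookkeeping] -/
def Row.deciding (r : Row) : Bool := r.atThree && (r.component == .nonsplit || r.component == .any)

/-- The coordinator's three-outcome form (operator relay 2026-08-22T11:27:08Z (5); R-59 (b)): «YES-candidate» needs one DECIDING
row SEMIREG+CLASS; «STRUCTURAL-NO» = an all-object barrier on a deciding component stated and checked; otherwise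
«NO-in-families-tried». [bookkeeping] -/
inductive Outcome | yesCandidate | structuralNo | noInFamiliesTried
  deriving DecidableEq, Repr

/-- The three-outcome form as a FUNCTION of a census table, evaluated on its DECIDING rows: a YES row wins, else an all-object
barrier row gives STRUCTURAL-NO, else NO-in-families-tried. (A YES row at ×1 would already print here; the signed YES-bar is
stricter.) [bookkeeping] -/
def outcome (t : List Row) : Outcome :=
  if t.any (fun r => r.deciding && r.semiregAndClass) then .yesCandidate
  else if t.any (fun r => r.deciding && r.kind == .barrierAllObjects) then .structuralNo
  else .noInFamiliesTried

/-- The same form WITHOUT the deciding guard (every g = 6 row, split components included) — used below only to show that the guard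
is load-bearing: the split METHOD INSTANCES are in the table. [bookkeeping] -/
def outcomeUngated (t : List Row) : Outcome :=
  if t.any (fun r => r.atThree && r.semiregAndClass) then .yesCandidate
  else if t.any (fun r => r.atThree && r.kind == .barrierAllObjects) then .structuralNo
  else .noInFamiliesTried

/-- Number of rows of a table satisfying a Boolean test. [bookkeeping] -/
def count (t : List Row) (p : Row → Bool) : ℕ := (t.filter p).length

/-- Ids of the rows of a table satisfying a Boolean test, in table order. [bookkeeping] -/
def ids (t : List Row) (p : Row → Bool) : List String := (t.filter p).map Row.id

/-! ## (1) The roll-up numbers of record (VERDICT-G6 v1.0 § V-2; CENSUS §3 v3.75 → v3.77 «219 = 218 + C14-16») -/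

/-- 219 table rows at v3.77. [bookkeeping] -/
theorem table_rows : census.length = 219 := by decide +kernel

/-- 218 rows of the SIGNED pin v3.75. [bookkeeping] -/
theorem signed_rows : count census (fun r => r.signed) = 218 := by decide +kernel

/-- The one post-signing row, by name: C14-16 (t-14 g8 PROPOSITION K; structure ∕ negative row, no object, «0 counted»).
[bookkeeping] -/
theorem postSigning_ids : ids census (fun r => !r.signed) = ["C14-16"] := by decide +kernel

/-- Rows per family at v3.77: A 59 · B 45 · C 48 · D 39 · D-L 4 · L 2 · K 22 (= 219). [bookkeeping] -/
theorem rows_by_family :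
    (count census (fun r => r.family == .A), count census (fun r => r.family == .B), count census (fun r => r.family == .C),
     count census (fun r => r.family == .D), count census (fun r => r.family == .DL), count census (fun r => r.family == .L),
     count census (fun r => r.family == .K)) = (59, 45, 48, 39, 4, 2, 22) := by decide +kernel

/-- Rows per family of the SIGNED pin: A 59 · B 45 · C 47 · D 39 + D-L 4 (= «D 43») · L 2 · K 22 (= 218) — the V-2 line.
[bookkeeping] -/
theorem signed_rows_by_family :
    (count census (fun r => r.signed && r.family == .A), count census (fun r => r.signed && r.family == .B),
     count census (fun r => r.signed && r.family == .C),
     count census (fun r => r.signed && (r.family == .D || r.family == .DL)),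
     count census (fun r => r.signed && r.family == .L), count census (fun r => r.signed && r.family == .K)) =
    (59, 45, 47, 43, 2, 22) := by decide +kernel

/-- 188 of the 219 rows are g = 6 statements (n = 3); 134 of them are DECIDING (read on a non-split component: 123 `nonsplit` +
11 `any`), 40 are split-only, 14 attach to no component. [bookkeeping] -/
theorem rows_at_three :
    (count census Row.atThree, count census Row.deciding,
     count census (fun r => r.atThree && r.component == .nonsplit), count census (fun r => r.atThree && r.component == .any),
     count census (fun r => r.atThree && r.component == .split), count census (fun r => r.atThree && r.component == .none)) =
    (188, 134, 123, 11, 40, 14) := by decide +kernel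

/-! ## (2) The certified negative statement on the DECIDING rows («non-split SEMIREG ∧ CLASS-OK 0»; «candidates 0») -/

/-- **SEMIREG ∧ CLASS = 0 on every deciding row.** No row of the census read on a NON-SPLIT g = 6 component — counted or
post-signing, member, structure row or calibration, any family, any anchor — has BOTH halves: CLASS-EXACT ∧ W-ALIVE and σ ∕ π
injective. A fortiori no row meets the YES trigger A5 (×2 in both cells): «candidates 0». [bookkeeping; the cells are the
census of record, transcribed] -/
theorem no_semireg_and_class_on_deciding_rows : ∀ r ∈ census, r.deciding = true → r.semiregAndClass = false := by
  decide +kernel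

/-- The same, counted: 0 rows. [bookkeeping] -/
theorem semireg_and_class_deciding_count : count census (fun r => r.deciding && r.semiregAndClass) = 0 := by decide +kernel

/-- **Every g = 6 row with both halves sits on a SPLIT component** (method-instance territory, in print): the intersection
«SEMIREG ∧ CLASS-OK» is EMPTY off the split components. [bookkeeping] -/
theorem semiregAndClass_rows_at_g6_are_split : ∀ r ∈ census, r.n = 3 → r.semiregAndClass = true → r.component = .split := by
  decide +kernel

/-- **No row carries the verdict SEMIREG+CLASS on a deciding component** (the census's CANDIDATE word): every `semiregClass`
verdict row is split-only (16 at n = 3, and the g = 4 anchor K-0a at n = 2). [bookkeeping] -/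
theorem semiregClass_verdict_rows_are_split : ∀ r ∈ census, r.verdict = .semiregClass → r.component = .split := by
  decide +kernel

/-- **MISSES-CLASS (red-6 F-3 headline at g = 6): every σ-injective deciding row is CLASS-DEAD** — the A-family members at R1 ∕ R3
(66 ∕ 51 ×3), the sub-torus supports B11-3 ∕ 4, B11-7 ∕ 9 ∕ 12 ∕ 14, C15-1, the C9 flat unions D-8 ∕ D-9 ∕ D-11c («semiregular in
the model»), D-24 and the CTRL catalogue D-27: 45 rows, class cell `dead` in every one. [bookkeeping] -/
theorem injective_deciding_rows_are_classDead : ∀ r ∈ census, r.deciding = true → r.sigma = .injective → r.cls = .dead := by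
  decide +kernel

/-- The σ-injective deciding rows by name (45). [bookkeeping] -/
theorem injective_deciding_rows : ids census (fun r => r.deciding && r.sigma == .injective) =
    ["A-0 (= engine-2 id Ke2-2)", "A9-0", "A9-1·X2", "A9-1·X3", "A9-2·X2", "A9-2·X3", "A9-3·X2", "A9-3·X3", "A9-4·X2",
     "A9-4·X3", "A9-5·X2", "A9-5·X3", "A9-6·X2", "A9-6·X3", "A9-7·X2", "A9-7·X3", "A9-8·X2", "A9-8·X3", "A9-9·X2", "A9-10·X2",
     "A9-10·X3", "A9-11·X2", "A9-11·X3", "A9-12·X2", "A9-12·X3", "A9-14·X2", "A9-14·X3", "A10-1", "A10-2", "A10-3", "A10-5",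
     "A10-4d", "B11-1", "B11-3", "B11-4", "B11-7", "B11-9", "B11-12", "B11-14", "C15-1", "D-8", "D-9", "D-11c", "D-24",
     "D-27"] := by decide +kernel

/-- **Every class-exact ∧ W-alive deciding row fails or lacks the σ half**: its σ cell is OBSTRUCTED (19), UNDECIDED (13) or absent
(6) — never injective. [bookkeeping] -/
theorem classOk_deciding_rows_not_injective : ∀ r ∈ census, r.deciding = true → r.cls = .ok → r.sigma ≠ .injective := by
  decide +kernel

/-- The class-exact ∧ W-alive deciding rows by name (38) with the σ-half histogram (obstructed, undecided, none) = (19, 13, 6):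
obstructed — A25-4 (LEMMA PD1), B11-11 ∕ B11-15 (virtual graph classes), B11-17 (THEOREM ω-ROW KILL), B12-4 (window + quiver),
B12-5, B12-6a ∕ 6b ∕ 6c ∕ 6d ∕ 7 ∕ 8 (h-free product laws: THEOREM V ∕ T5-23 words of record, NEG #13), B12-11b ∕ 12b (WINDOW-DEAD),
C13-20 ∕ 21, D-17 (NEG #3), D-18 (not lci), D-29 #2 (count); undecided — A25-5, B11-16, the h-seeing door B12-9 ∕ 9b ∕ 9c ∕ 10 and
its members B12-11a ∕ 12a ∕ 13, the ladder calibrations B12-14 ∕ 15 ∕ 16, D-16 fat designs; none — A9-17, A25-3, A25-6, C13-18,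
C14-14, D-13 (no object ∕ not lci). [bookkeeping] -/
theorem classOk_deciding_rows :
    ids census (fun r => r.deciding && r.cls == .ok) =
      ["A9-17", "A25-3", "A25-4", "A25-5", "A25-6", "B11-11", "B11-15", "B11-16", "B11-17", "B12-4", "B12-5", "B12-6a",
       "B12-6b", "B12-6c", "B12-6d", "B12-7", "B12-8", "B12-9", "B12-9b", "B12-9c", "B12-10", "B12-11a", "B12-11b", "B12-12a",
       "B12-12b", "B12-13", "B12-14", "B12-15", "B12-16", "C13-18", "C13-20", "C13-21", "C14-14", "D-13", "D-16", "D-17",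
       "D-18", "D-29"] ∧
    (count census (fun r => r.deciding && r.cls == .ok && r.sigma == .obstructed),
     count census (fun r => r.deciding && r.cls == .ok && r.sigma == .undecided),
     count census (fun r => r.deciding && r.cls == .ok && r.sigma == .none)) = (19, 13, 6) := by decide +kernel

/-- Per family, the g = 6 negative in the census's verdict vocabulary: the DECIDING rows of each family split into SEMIREG+CLASS ·
SEMIREG ∕ CLASS-DEAD · CLASS-OK ∕ NOT-SEMIREG · NOT-SEMIREG · CLASS-DEAD · no-object · open ∕ undecided · structural · calibration ·
pointer, with 0 in the SEMIREG+CLASS column everywhere («NO-in-families-tried SUPPORTED family by family»: A misses class, B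
obstructed ∕ dead by theorem or σ-undecided, C closed at class level on non-split data, D per sub-family). Columns in that order; rows
A, B, C, D, L (the D-L ladder rows and the K calibrations have no deciding row). [bookkeeping] -/
theorem verdict_histogram_by_family_deciding :
    (let h := fun (f : Family) (v : Verdict) => count census (fun r => r.deciding && r.family == f && r.verdict == v)
     [Family.A, .B, .C, .D, .L].map fun f =>
        [h f .semiregClass, h f .semiregClassDead, h f .classOkNotSemireg, h f .notSemireg, h f .classDead,
         h f .noObject, h f .openOrUndecided, h f .structural, h f .calibration, h f .pointer]) =
    [[0, 32, 0, 4, 11, 1, 3, 3, 0, 1],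
     [0, 6, 12, 2, 5, 0, 10, 1, 0, 2],
     [0, 1, 0, 2, 2, 0, 0, 8, 0, 0],
     [0, 3, 1, 4, 8, 3, 4, 3, 0, 0],
     [0, 0, 0, 0, 0, 0, 0, 2, 0, 0]] := by decide +kernel

/-- No deciding row at all in the ladder (D-L, levels 4 ∕ 5) and calibration (K) families. [bookkeeping] -/
theorem no_deciding_row_in_DL_K : ∀ r ∈ census, (r.family = .DL ∨ r.family = .K) → r.deciding = false := by decide +kernel

/-! ## (3) The signed «38 SEMIREG+CLASS-worded cells» and «9 deciding cells with a YES token», by name -/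

/-- **The 38 SEMIREG+CLASS-worded verdict cells** (the numbers referee's regex of record on c10), by name — «all split ∕ g = 4-in-print
∕ control ∕ negative»: 13 of them carry both halves and are SPLIT (B11-8 = D-1 control, C14-3 ∕ 5 ∕ 8 ∕ 11 ∕ 12, D-1…D-6) or the
g = 4 anchor (K-0a); the other 25 are negative ∕ open ∕ structural ∕ calibration wordings («never a candidate», «not a CANDIDATE»,
«candidate NEGATIVE #k», «would be a CANDIDATE»). [bookkeeping] -/
theorem scWord_rows :
    ids census Row.scWord =
      ["A-0 (= engine-2 id Ke2-2)", "A9-0", "A25-2", "A9-17", "A25-3", "A25-5", "B11-8", "B11-16", "B11-17", "B12-9", "B12-9b",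
       "C13-25", "C13-26", "C14-3", "C14-5", "C14-8", "C14-11", "C14-12", "C14-15", "D-1", "D-2", "D-3", "D-4", "D-5", "D-6",
       "D-11", "D-11b", "D-11c", "D-13", "D-14", "D-14b", "D-15", "D-29", "D-29b", "L-1", "L-2", "K-0a", "K-11"] ∧
    count census Row.scWord = 38 := by decide +kernel

/-- Among the 38, the rows WITH both halves are exactly the split instances + the g = 4 anchor; none is deciding. [bookkeeping] -/
theorem scWord_rows_with_both_halves :
    ids census (fun r => r.scWord && r.semiregAndClass) =
      ["B11-8", "C14-3", "C14-5", "C14-8", "C14-11", "C14-12", "D-1", "D-2", "D-3", "D-4", "D-5", "D-6", "K-0a"] ∧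
    (∀ r ∈ census, r.scWord = true → r.semiregAndClass = true → r.component = .split ∧ (r.n = 3 ∨ r.n = 2)) := by
  decide +kernel

/-- **The 9 deciding cells with a bare YES token** (the referee's rule on c11), by name — «UNDECIDED ∕ component ∕ conditional»: the
h-seeing door B12-9 ∕ 9b ∕ 9c ∕ 10 (σ-UNDECIDED), B12-14 (THEOREM (γ″), σ-undecided), C14-15 ∕ D-29b ∕ D-29c (structure rows, no
object), D-29 (E-trivial door, NOT semiregular by count); none has an injective σ cell, none has both halves. [bookkeeping] -/
theorem yesToken_rows :
    ids census Row.yesToken = ["B12-9", "B12-9b", "B12-9c", "B12-10", "B12-14", "C14-15", "D-29", "D-29b", "D-29c"] ∧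
    (∀ r ∈ census, r.yesToken = true → r.sigma ≠ .injective ∧ r.semiregAndClass = false) := by decide +kernel

/-! ## (4) «YES as METHOD INSTANCES on split components» — the rows with both halves, by name -/

/-- **The g = 6 rows with BOTH halves, by name (17), every one on a SPLIT component**: B11-8 (= D-1, Markman control, equivariant door,
in print), C13-8 (triangle sheaf, ℚ(√−7) ∕ ℚ(√−3)), C13-10 (over-braced K₄ skeleta, ℚ(√−11)), C13-12 (−364 member, ℚ(√−91)),
C13-13 (F₄ instance, ℚ(i)), C13-16 (K-matched AJ instance, ℚ(√−3)), C14-3 (theta members at second CM points), C14-5 ∕ 8 ∕ 11 ∕ 12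
(∣2Θ∣ ∕ Prym-pencil NL-rigid members), D-1 (Markman control), D-2…D-6 (THETA-SECANT E_m ⊗ M, five fields, rank 48 = bound 48) —
METHOD INSTANCES, «never the g = 6 answer», deciding NO. [bookkeeping] -/
theorem semiregAndClass_rows_g6 :
    ids census (fun r => r.atThree && r.semiregAndClass) =
      ["B11-8", "C13-8", "C13-10", "C13-12", "C13-13", "C13-16", "C14-3", "C14-5", "C14-8", "C14-11", "C14-12", "D-1", "D-2",
       "D-3", "D-4", "D-5", "D-6"] ∧
    (∀ r ∈ census, r.atThree = true → r.semiregAndClass = true → r.component = .split) := by decide +kernel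

/-- In the WHOLE table the remaining both-halves rows are the g = 4 anchor carried as calibration: B11-cal2 (k = 0: K-0a's numbers
(12, 12, 0)), K-0a (STEP-0 YES, split, in print) and K-C13-2 (the signed 28 ∕ 18 ∕ 18 ∕ 10 object) — all at n = 2, all split.
[bookkeeping] -/
theorem semiregAndClass_rows_other_levels :
    (census.filter fun r => !r.atThree && r.semiregAndClass).map (fun r => (r.id, r.n)) =
      [("B11-cal2", 2), ("K-0a", 2), ("K-C13-2", 2)] ∧
    (∀ r ∈ census, r.semiregAndClass = true → r.component = .split) := by decide +kernel

/-! ## (5) The three-outcome form -/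

/-- **No all-object barrier row exists** (every structural kill of record is family- ∕ type-scoped: THEOREM A′ ∕ 2BOX for family A,
TYPE LEMMA ∕ THEOREM V ∕ T5-23 ∕ ω-ROW KILL for family B, the coordinate ∕ transplant theorems C13-17…26 for family C, NEG #1…#14, the
provisional VOISIN barrier D-30 for h-free secant classes) — so «STRUCTURAL-NO» is NOT claimed. [bookkeeping] -/
theorem no_allObject_barrier_row_g6 :
    ids census (fun r => r.kind == .barrierAllObjects) = [] ∧ ∀ r ∈ census, r.deciding = true → r.kind ≠ .barrierAllObjects := by
  decide +kernel

/-- **§ V-1 FORM = «NO-in-families-tried»**: the three-outcome form evaluated on the deciding rows of the census of record.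
[bookkeeping] -/
theorem outcome_g6 : outcome census = .noInFamiliesTried := by decide +kernel

/-- The form is STABLE under dropping the post-signing row: the 218 rows of the signed pin alone give the same value (cells as they
read at v3.77; the custodian's §5 log records cell folds but no verdict-word change on these rows since v3.75). [bookkeeping] -/
theorem outcome_g6_signed : outcome (census.filter fun r => r.signed) = .noInFamiliesTried := by decide +kernel

/-- **The deciding guard is load-bearing**: read over ALL g = 6 rows (split components included) the same form prints YES — these are
the split METHOD INSTANCES of (4), in print territory, «never the g = 6 answer» (V-1: YES as method instances on split components;
the cell's question is the non-split components). [bookkeeping] -/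
theorem outcomeUngated_reads_yes_from_split_instances : outcomeUngated census = .yesCandidate := by decide +kernel

/-- The form reads YES-candidate as soon as SOME deciding row of the table has both halves (how the function is meant: the A5 event).
[bookkeeping] -/
theorem outcome_eq_yesCandidate_of_mem {t : List Row} {r : Row} (hr : r ∈ t) (hd : r.deciding = true)
    (hs : r.semiregAndClass = true) : outcome t = .yesCandidate := by
  have h : t.any (fun r => r.deciding && r.semiregAndClass) = true :=
    List.any_eq_true.mpr ⟨r, hr, by simp [hd, hs]⟩
  rw [outcome, if_pos h]

/-- What WOULD flip it (for the record): appending any one non-split g = 6 row with both halves makes the form read YES-candidate —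
the function is not vacuously NO on tables of this shape. [bookkeeping] -/
theorem outcome_flips_on_a_deciding_yes_row (x : String) (f : Family) (k : Kind) (v : Verdict) (b₁ b₂ b₃ : Bool) :
    outcome (census ++ [Row.mk x f b₁ 3 .nonsplit k .ok .injective v b₂ b₃]) = .yesCandidate :=
  outcome_eq_yesCandidate_of_mem (List.mem_append_right census (List.mem_singleton_self _)) rfl rfl

/-! ## (6) The open rows and the two doors of record -/

/-- The 18 g = 6 rows whose verdict cell reads OPEN ∕ UNDECIDED (incl. named open cells), by name: A25-2 (normalised residual object
question), A9-17 ((4∣2)-cut design cell), A25-5 (slanted strata design), B11-16 (talking complexes, OPEN ∕ STRUCTURAL-ONLY), the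
family-B h-seeing door B12-9 ∕ 9b ∕ 9c ∕ 10 and its members B12-11a (R2) ∕ 12a (R3) ∕ 13, the ladder calibrations B12-15 ∕ 16,
door (I) D-14 (U(3;cube)), D-16 (fat hexagon designs), D-20 (Schoen–Prym cycles, no AJ engine), D-26 (GS theta arrangement on a SPLIT
model: LEMMA-DEAD for the G-door, σ itself undecided), De2-R3-1 (μ₄ universe at R3). None has a σ number (σ cell UNDECIDED or none);
all but the split row D-26 are deciding-territory rows. [bookkeeping] -/
theorem open_rows_g6 :
    ids census (fun r => r.atThree && r.verdict == .openOrUndecided) =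
      ["A25-2", "A9-17", "A25-5", "B11-16", "B12-9", "B12-9b", "B12-9c", "B12-10", "B12-11a", "B12-12a", "B12-13", "B12-15",
       "B12-16", "D-14", "D-16", "D-20", "D-26", "De2-R3-1"] ∧
    (∀ r ∈ census, r.verdict = .openOrUndecided → r.sigma = .undecided ∨ r.sigma = .none) ∧
    ids census (fun r => r.atThree && r.verdict == .openOrUndecided && !r.deciding) = ["D-26"] := by
  decide +kernel

/-- **The door ledger of record (V-1): TWO live doors on R1, both UNDECIDED** — (I) the C9 placement door D-14 (no object yet: class
cell undecided, no σ) and (II) the family-B h-seeing door B12-9 ∕ 9b ∕ 9c ∕ 10 (class-exact ∧ W-alive, σ NOT COMPUTED) — as their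
cells read in the table. [bookkeeping] -/
theorem door_ledger_rows :
    (census.filter fun r => r.id ∈ ["D-14", "B12-9", "B12-9b", "B12-9c", "B12-10"]).map
        (fun r => (r.id, r.component, r.cls, r.sigma, r.verdict)) =
      [("B12-9", .nonsplit, .ok, .undecided, .openOrUndecided), ("B12-9b", .nonsplit, .ok, .undecided, .openOrUndecided),
       ("B12-9c", .nonsplit, .ok, .undecided, .openOrUndecided), ("B12-10", .nonsplit, .ok, .undecided, .openOrUndecided),
       ("D-14", .nonsplit, .undecided, .none, .openOrUndecided)] := by decide +kernel

/-! ## (7) Rows carried at other levels -/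

/-- The 31 rows carried at a level other than n = 3 (the g = 2 ∕ g = 4 calibrations, the n-tables and uniform-in-n laws (n = 0), the
ladder rows at n = 4 ∕ 5, the N6 Jacobian rungs D-32 ∕ 33 at n = 6), by name with their level — these are not g = 6 statements and are
excluded from (2) by the `n = 3` guard, not by fiat. [bookkeeping] -/
theorem rows_not_at_three : (census.filter fun r => !r.atThree).map (fun r => (r.id, r.n)) =
    [("B11-cal1", 1), ("B11-cal2", 2), ("B11-cal3", 2), ("B11-cal4", 2), ("C13-14", 0), ("C13-25", 0), ("C14-9", 0),
     ("C14-13", 0), ("D-L1", 4), ("D-L2", 0), ("D-L3", 4), ("D-L4", 5), ("D-28", 0), ("D-30", 0), ("D-32", 6), ("D-33", 6),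
     ("K-0a", 2), ("K-0b", 1), ("K-10", 0), ("K-11", 0), ("K-A-1", 1), ("K-A-2 (= Ke2-1)", 2), ("K-A-4 (= Ke2-3)", 4),
     ("K-C13-1", 1), ("K-C13-2", 2), ("K-A9-1", 1), ("K-A9-2", 2), ("K-A10-1", 2), ("K-A10-2", 1), ("K-C14-1", 1),
     ("K-C14-2", 2)] := by decide +kernel

end Summit.Ventures.HSemireg.CensusG6
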